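import Summits.QuantumFields.GaugeBoot.TiltedBoxTwoDimMidBlocks
import Summits.QuantumFields.GaugeBoot.TiltedBoxAxisRPNegativeGaugeInvariant
import HarnessLib

/-!
# The even square tilted box in two dimensions: the reduced half of the site mirror, its blocks, two annuli (gauge-boot, L3 supplement: 2D slab gluing, reduced-half site mirror 1/4)

HONEST FRAMING (cell `pub-gaugeboot`, page 1 of every file): the venture produces certified bounds
on lattice expectations at stated coupling, gauge group, dimension and torus size; NOT a mass gap,
NOT a continuum limit, NOT a string tension; NOT Yang–Mills-summit-bearing (barriers
`FixedCouplingUltralocality`, `PerturbativeInvisibility`). Geometric bookkeeping for the POSITIVE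
two-dimensional result `TiltedBoxEvenAxisRPTwoDim.lean`; it discharges nothing else.

Setting: the EVEN square box `ℤ^d/Γ(2P, 2P, L)`, `P ≥ 2`, in two dimensions (`∀ k, k = i ∨ k = j`), the
SITE mirror `Θ_i : x_i ↦ -x_i` (`configReflect` of the flip `σ = tiltedAxisFlip`). Its fixed loci are the
layer `x_i ≡ 0` (pointwise fixed) and the LAYER `x_i ≡ P`, mapped onto itself twisted by `T = [2P e_j]`
(`tiltedAxisFlip_of_axisCoord_eq_half`), which is why closed-half site RP for `{0 ≤ x_i ≤ P}` fails at
every `β` in every `d ≥ 2` (`not_tiltedBox_axisRP`). This module prepares the REDUCED half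
`{0 ≤ x_i ≤ P - 1}` (`IsRedSiteLink`), which leaves the twisted layer FREE: between the half (top layer
`P - 1`) and its mirror image (bottom layer `P + 1`) sit the annuli `P-1|P`, `P|P+1` and the free layer `P`;
the layer `0` is SHARED (its `j`-links are fixed by `Θ_i`).

* `shBlockE` / `posBlockE` — shared and positive links, `isRedSiteLink_iff_mem_blocksE` (two dimensions);
  `Θ_i` fixes the shared block and reads every positive link off the complement of the positive block
  (`configReflect_apply_of_mem_shBlockE`, `dependsOn_configReflect_apply_even`) — the hypotheses of the
  tree's shared-block mechanism;
* the twist of the layer `P - 1`: `tiltedAxisFlip_of_axisCoord_eq_pred` (`σ y = y + 2e_i + T`),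
  `tiltedAxisFlip_cyc_pred`; the base sites `predLayerSite` (layer `P - 1`), `layerSite` (layer `P`);
* rungs of the two annuli and letters of the free layer are neither positive nor shared, and mirror images
  of block links are never rungs or free letters.

References: K. Osterwalder, E. Seiler, Ann. Phys. 110 (1978) 440, §2; J. Fröhlich, R. Israel,
E. H. Lieb, B. Simon, J. Stat. Phys. 22 (1980) 297, §3.
-/

noncomputable section

open QuotientAddGroup Finset Function MeasureTheory

namespace Summit.QuantumFields.GaugeBoot

namespace TiltedRP

namespace TwoDim

variable {d : ℕ} {i j : Fin d} {L P : ℕ}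

section EvenSite

variable [NeZero L] [NeZero P]

/-! ## `val` arithmetic modulo `2P` -/

omit [NeZero L] [NeZero P] in
/-- `(-a - 1).val = 2P - 1 - a.val` in `ZMod (2P)`. [folklore] -/
theorem val_neg_sub_one (hP : 2 ≤ P) (a : ZMod (2 * P)) : (-a - 1).val = 2 * P - 1 - a.val := by
  have ha := val_lt_two_mul hP a
  have h1 : (-a - 1 : ZMod (2 * P)) = -(a + 1) := by ring
  rw [h1, val_neg hP]
  by_cases htop : a.val + 1 = 2 * P
  · have h2 : (a + 1).val = 0 := by rw [val_add_one hP, if_pos htop]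
    rw [if_pos h2]
    omega
  · have h2 : (a + 1).val = a.val + 1 := by rw [val_add_one hP, if_neg htop]
    have h3 : a.val + 1 ≠ 0 := by omega
    rw [h2, if_neg h3, Nat.sub_sub, add_comm]

/-! ## The base sites of the layers `P - 1`, `P`, `P + 1` -/

variable (d L P) in
/-- The reference site `[(P-1) e_i]` of the layer `x_i ≡ P - 1` (top layer of the reduced half). -/
def predLayerSite : TiltedSite d i j (2 * P) (2 * P) L :=
  (layerSite d L P : TiltedSite d i j (2 * P) (2 * P) L) - tiltedUnit d i j (2 * P) (2 * P) L i

omit [NeZero L] [NeZero P] in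
/-- `x_i(y₋) = P - 1`. [folklore] -/
theorem axisCoord_predLayerSite :
    axisCoord d L (2 * P) (predLayerSite d L P : TiltedSite d i j (2 * P) (2 * P) L) = ((P : ℕ) : ZMod (2 * P)) - 1 := by
  rw [predLayerSite, map_sub, axisCoord_layerSite, axisCoord_tiltedUnit_self]

omit [NeZero L] [NeZero P] in
/-- `((P : ZMod 2P) - 1).val = P - 1`. [folklore] -/
theorem val_natCast_sub_one (hP : 2 ≤ P) : (((P : ℕ) : ZMod (2 * P)) - 1).val = P - 1 := by
  rw [show ((P : ℕ) : ZMod (2 * P)) - 1 = ((P - 1 : ℕ) : ZMod (2 * P)) by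
    rw [Nat.cast_sub (by omega), Nat.cast_one], ZMod.val_natCast, Nat.mod_eq_of_lt (by omega)]

omit [NeZero L] [NeZero P] in
/-- `x_i(y₋) = P - 1` as a natural number. [folklore] -/
theorem val_axisCoord_predLayerSite (hP : 2 ≤ P) :
    (axisCoord d L (2 * P) (predLayerSite d L P : TiltedSite d i j (2 * P) (2 * P) L)).val = P - 1 := by
  rw [axisCoord_predLayerSite, val_natCast_sub_one hP]

omit [NeZero L] [NeZero P] in
/-- `x_i(y₀) = P` as a natural number. [folklore] -/
theorem val_axisCoord_layerSite (hP : 2 ≤ P) :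
    (axisCoord d L (2 * P) (layerSite d L P : TiltedSite d i j (2 * P) (2 * P) L)).val = P := by
  rw [axisCoord_layerSite, val_natCast_self hP]

omit [NeZero L] [NeZero P] in
/-- `x_i(y₀ + e_i) = P + 1` as a natural number. [folklore] -/
theorem val_axisCoord_layerSite_add (hP : 2 ≤ P) :
    (axisCoord d L (2 * P) ((layerSite d L P : TiltedSite d i j (2 * P) (2 * P) L) + tiltedUnit d i j (2 * P) (2 * P) L i)).val
      = P + 1 := by
  rw [axisCoord_add_tiltedUnit, if_pos rfl, val_add_one hP, axisCoord_layerSite, val_natCast_self hP, if_neg (by omega)]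

/-! ## The twist of the layer `P - 1` -/

omit [NeZero L] [NeZero P] in
/-- **The twist lemma for the layer `P - 1` of the even box**: `σ y = y + 2 e_i + T`
(`-(x_i) ≡ x_i + 2 (mod 2P)` up to the half period: `2P(e_i + e_j) ∈ Γ`). [folklore] -/
theorem tiltedAxisFlip_of_axisCoord_eq_pred (hij : i ≠ j) (q : TiltedSite d i j (2 * P) (2 * P) L)
    (hq : axisCoord d L (2 * P) q = ((P : ℕ) : ZMod (2 * P)) - 1) :
    tiltedAxisFlip d L (2 * P) hij q =
      q + tiltedUnit d i j (2 * P) (2 * P) L i + tiltedUnit d i j (2 * P) (2 * P) L i + tiltedTwist d L (2 * P) := by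
  induction q using QuotientAddGroup.induction_on with
  | H x =>
    rw [axisCoord_mk] at hq
    have hdvd : (((2 * P : ℕ)) : ℤ) ∣ ((P : ℤ) - 1) - x i := by
      rw [← ZMod.intCast_eq_intCast_iff_dvd_sub]; push_cast; exact_mod_cast hq
    obtain ⟨a, ha⟩ := hdvd
    rw [tiltedAxisFlip_mk, tiltedUnit, tiltedTwist, ← QuotientAddGroup.mk_add, ← QuotientAddGroup.mk_add,
      ← QuotientAddGroup.mk_add, QuotientAddGroup.eq, mem_tiltedLattice_iff]
    simp only [Pi.add_apply, Pi.neg_apply, negHom_apply, if_neg (Ne.symm hij), Pi.single_eq_same,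
      Pi.single_eq_of_ne hij, Pi.single_eq_of_ne (Ne.symm hij), if_true]
    have hxi : x i = (P : ℤ) - 1 - (2 * P : ℕ) * a := by linarith
    refine ⟨⟨1 - a, ?_⟩, ⟨-a, ?_⟩, fun k hki hkj => ?_⟩
    · rw [hxi]; push_cast; ring
    · rw [hxi]; push_cast; ring
    · rw [if_neg hki, Pi.single_eq_of_ne hki, Pi.single_eq_of_ne hkj]; simp

omit [NeZero L] [NeZero P] in
/-- **The twist along the cycle of the layer `P - 1`**: `σ (y₋ + t e_j) = (y₀ + e_i) + (t + 2P) e_j`. [folklore] -/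
theorem tiltedAxisFlip_cyc_pred (hij : i ≠ j) (t : ℕ) :
    tiltedAxisFlip d L (2 * P) hij (cyc (predLayerSite d L P : TiltedSite d i j (2 * P) (2 * P) L) t) =
      cyc ((layerSite d L P : TiltedSite d i j (2 * P) (2 * P) L) + tiltedUnit d i j (2 * P) (2 * P) L i) (t + 2 * P) := by
  rw [tiltedAxisFlip_of_axisCoord_eq_pred hij _ (by rw [axisCoord_cyc hij, axisCoord_predLayerSite]), ← cyc_add_tiltedTwist]
  unfold cyc predLayerSite
  abel

/-! ## The reduced half, the shared and the positive block -/

/-- **A link of the REDUCED half** `{0 ≤ x_i ≤ P - 1}` of the site mirror on the even box: both endpoints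
in it (the twisted layer `x_i ≡ P` is left out). -/
def IsRedSiteLink (l : Link (TiltedSite d i j (2 * P) (2 * P) L) d) : Prop :=
  (axisCoord d L (2 * P) l.1).val + 1 ≤ P ∧
    (axisCoord d L (2 * P) (l.1 + tiltedUnit d i j (2 * P) (2 * P) L l.2)).val + 1 ≤ P

/-- The SHARED block: the `j`-links of the pointwise fixed layer `x_i ≡ 0`. -/
def shBlockE (d : ℕ) (i j : Fin d) (L P : ℕ) [NeZero L] [NeZero P] :
    Finset (Link (TiltedSite d i j (2 * P) (2 * P) L) d) :=
  Finset.univ.filter fun l => l.2 = j ∧ axisCoord d L (2 * P) l.1 = 0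

/-- The POSITIVE block: `j`-links of the layers `1 … P-1` and `i`-links based in the layers `0 … P-2`. -/
def posBlockE (d : ℕ) (i j : Fin d) (L P : ℕ) [NeZero L] [NeZero P] :
    Finset (Link (TiltedSite d i j (2 * P) (2 * P) L) d) :=
  Finset.univ.filter fun l =>
    (l.2 = j ∧ 1 ≤ (axisCoord d L (2 * P) l.1).val ∧ (axisCoord d L (2 * P) l.1).val + 1 ≤ P) ∨
    (l.2 = i ∧ (axisCoord d L (2 * P) l.1).val + 2 ≤ P)

/-- Membership in the shared block. [folklore] -/
theorem mem_shBlockE {l : Link (TiltedSite d i j (2 * P) (2 * P) L) d} :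
    l ∈ shBlockE d i j L P ↔ l.2 = j ∧ axisCoord d L (2 * P) l.1 = 0 := by
  simp [shBlockE]

/-- Membership in the positive block. [folklore] -/
theorem mem_posBlockE {l : Link (TiltedSite d i j (2 * P) (2 * P) L) d} :
    l ∈ posBlockE d i j L P ↔
      (l.2 = j ∧ 1 ≤ (axisCoord d L (2 * P) l.1).val ∧ (axisCoord d L (2 * P) l.1).val + 1 ≤ P) ∨
      (l.2 = i ∧ (axisCoord d L (2 * P) l.1).val + 2 ≤ P) := by
  simp [posBlockE]

/-- The two blocks are disjoint. [folklore] -/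
theorem disjoint_shBlockE_posBlockE (hij : i ≠ j) : Disjoint (shBlockE d i j L P) (posBlockE d i j L P) := by
  rw [Finset.disjoint_left]
  intro l hs hp
  rw [mem_shBlockE] at hs
  rw [mem_posBlockE] at hp
  rcases hp with ⟨-, h1, -⟩ | ⟨h2, -⟩
  · rw [hs.2, ZMod.val_zero] at h1; omega
  · exact hij (h2.symm.trans hs.1)

/-- **The links of the reduced half are the shared and the positive links** (two dimensions, `P ≥ 2`). [folklore] -/
theorem isRedSiteLink_iff_mem_blocksE (hP : 2 ≤ P) (hij : i ≠ j) (hd : ∀ k : Fin d, k = i ∨ k = j)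
    (l : Link (TiltedSite d i j (2 * P) (2 * P) L) d) :
    IsRedSiteLink l ↔ l ∈ posBlockE d i j L P ∨ l ∈ shBlockE d i j L P := by
  obtain ⟨x, k⟩ := l
  have hc := val_lt_two_mul hP (axisCoord d L (2 * P) x)
  have h0 : axisCoord d L (2 * P) x = 0 ↔ (axisCoord d L (2 * P) x).val = 0 := eq_zero_iff_val _
  rw [IsRedSiteLink, mem_posBlockE, mem_shBlockE, axisCoord_add_tiltedUnit]
  simp only
  rcases hd k with hk | hk
  · rw [hk, if_pos rfl, val_add_one hP]
    simp only [hij, false_and, false_or, true_and, or_false]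
    split_ifs with h <;> omega
  · rw [hk, if_neg (Ne.symm hij), add_zero, h0]
    simp only [Ne.symm hij, false_and, or_false, true_and]
    omega

/-- The flip fixes the shared links. [folklore] -/
theorem configReflect_apply_of_mem_shBlockE {G : Type*} [Group G] (hij : i ≠ j)
    (U : Config (TiltedSite d i j (2 * P) (2 * P) L) d G)
    {l : Link (TiltedSite d i j (2 * P) (2 * P) L) d} (hl : l ∈ shBlockE d i j L P) :
    configReflect (tiltedUnit d i j (2 * P) (2 * P) L) i (tiltedAxisFlip d L (2 * P) hij) U l = U l := by
  obtain ⟨x, k⟩ := l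
  obtain ⟨hk, hx⟩ := mem_shBlockE.1 hl
  simp only at hk hx
  subst hk
  rw [configReflect_other _ i _ U x (Ne.symm hij), tiltedAxisFlip_eq_self_of_axisCoord_eq_zero d L _ hij x hx]

/-- **The flip reads a positive link off the complement of the positive block.** [folklore] -/
theorem siteLinkMap_not_mem_posBlockE (hP : 2 ≤ P) (hij : i ≠ j) (hd : ∀ k : Fin d, k = i ∨ k = j)
    {l : Link (TiltedSite d i j (2 * P) (2 * P) L) d} (hl : l ∈ posBlockE d i j L P) :
    siteLinkMap (tiltedUnit d i j (2 * P) (2 * P) L) i (tiltedAxisFlip d L (2 * P) hij) l ∉ posBlockE d i j L P := by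
  obtain ⟨x, k⟩ := l
  intro hmem
  have hc := val_lt_two_mul hP (axisCoord d L (2 * P) x)
  rcases hd k with hk | hk
  · -- `i`-link: new base `σ x - e_i`, coordinate `-x_i - 1`
    rw [hk] at hl hmem
    rw [siteLinkMap_self, mem_posBlockE] at hmem
    rw [mem_posBlockE] at hl
    simp only [hij, false_and, false_or, true_and] at hl hmem
    rw [map_sub, axisCoord_tiltedAxisFlip, axisCoord_tiltedUnit_self, val_neg_sub_one hP] at hmem
    omega
  · -- `j`-link: new base `σ x`, coordinate `-x_i`
    rw [hk] at hl hmem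
    rw [siteLinkMap_other _ i _ x (Ne.symm hij), mem_posBlockE] at hmem
    rw [mem_posBlockE] at hl
    simp only [Ne.symm hij, false_and, or_false, true_and] at hl hmem
    rw [axisCoord_tiltedAxisFlip, val_neg hP] at hmem
    split_ifs at hmem with h0 <;> omega

/-- The reflected value of a positive link depends only on the links off the positive block. [folklore] -/
theorem dependsOn_configReflect_apply_even {G : Type*} [Group G]
    [DecidableEq (TiltedSite d i j (2 * P) (2 * P) L)] (hP : 2 ≤ P) (hij : i ≠ j) (hd : ∀ k : Fin d, k = i ∨ k = j)
    (l : Link (TiltedSite d i j (2 * P) (2 * P) L) d) (hl : l ∈ posBlockE d i j L P ∪ ∅) :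
    DependsOn (fun U : Config (TiltedSite d i j (2 * P) (2 * P) L) d G =>
        configReflect (tiltedUnit d i j (2 * P) (2 * P) L) i (tiltedAxisFlip d L (2 * P) hij) U l)
      (((posBlockE d i j L P)ᶜ : Finset _) : Set _) := by
  rw [Finset.union_empty] at hl
  intro U V h
  have hmem : siteLinkMap (tiltedUnit d i j (2 * P) (2 * P) L) i (tiltedAxisFlip d L (2 * P) hij) l ∈
      (((posBlockE d i j L P)ᶜ : Finset _) : Set _) := by
    rw [Finset.coe_compl, Set.mem_compl_iff, Finset.mem_coe]
    exact siteLinkMap_not_mem_posBlockE hP hij hd hl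
  have hUV := h _ hmem
  show configReflect _ i _ U l = configReflect _ i _ V l
  unfold configReflect
  split_ifs <;> simp [hUV]

/-- The `j`-links of the layer `P - 1` (the lower letters of the annulus `P-1|P`, on the positive side)
are positive links (`P ≥ 2`). [folklore] -/
theorem aLink_mem_posBlockE (hP : 2 ≤ P) (hij : i ≠ j) (t : ℕ) :
    (cyc (predLayerSite d L P : TiltedSite d i j (2 * P) (2 * P) L) t, j) ∈ posBlockE d i j L P := by
  rw [mem_posBlockE]
  refine Or.inl ⟨rfl, ?_⟩
  show 1 ≤ (axisCoord d L (2 * P) (cyc (predLayerSite d L P) t)).val ∧ (axisCoord d L (2 * P) (cyc (predLayerSite d L P) t)).val + 1 ≤ P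
  rw [axisCoord_cyc hij, val_axisCoord_predLayerSite hP]
  omega

/-! ## Rungs of the two annuli and letters of the free layer -/

/-- An `i`-link based in the layer `P - 1` or `P` (a rung) is neither positive nor shared. [folklore] -/
theorem iLink_not_mem_blocksE (hij : i ≠ j) {x : TiltedSite d i j (2 * P) (2 * P) L}
    (hx : (axisCoord d L (2 * P) x).val = P - 1 ∨ (axisCoord d L (2 * P) x).val = P) :
    ¬ ((x, i) ∈ posBlockE d i j L P ∨ (x, i) ∈ shBlockE d i j L P) := by
  have hP : 1 ≤ P := Nat.one_le_iff_ne_zero.2 (NeZero.ne P)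
  rw [mem_posBlockE, mem_shBlockE]
  simp only [hij, false_and, false_or, true_and, or_false]
  omega

/-- A `j`-link of the free layer `x_i ≡ P` is neither positive nor shared. [folklore] -/
theorem freeLetter_not_mem_blocksE (hij : i ≠ j) {x : TiltedSite d i j (2 * P) (2 * P) L}
    (hx : (axisCoord d L (2 * P) x).val = P) : ¬ ((x, j) ∈ posBlockE d i j L P ∨ (x, j) ∈ shBlockE d i j L P) := by
  have hP : 1 ≤ P := Nat.one_le_iff_ne_zero.2 (NeZero.ne P)
  have h0 : axisCoord d L (2 * P) x = 0 ↔ (axisCoord d L (2 * P) x).val = 0 := eq_zero_iff_val _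
  rw [mem_posBlockE, mem_shBlockE, h0]
  simp only [Ne.symm hij, false_and, or_false, true_and]
  omega

/-- **The mirror image of a block link is never a rung** (a `j`-link, or an `i`-link `(σ x - e_i, i)` with
`x_i = 2P - 1 - x_i(x) ≥ P + 1`). [folklore] -/
theorem siteLinkMap_ne_rung_even (hP : 2 ≤ P) (hij : i ≠ j) (hd : ∀ k : Fin d, k = i ∨ k = j)
    {l : Link (TiltedSite d i j (2 * P) (2 * P) L) d} (hl : l ∈ posBlockE d i j L P ∨ l ∈ shBlockE d i j L P)
    {y : TiltedSite d i j (2 * P) (2 * P) L}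
    (hy : (axisCoord d L (2 * P) y).val = P - 1 ∨ (axisCoord d L (2 * P) y).val = P) (s : ℕ) :
    siteLinkMap (tiltedUnit d i j (2 * P) (2 * P) L) i (tiltedAxisFlip d L (2 * P) hij) l ≠ (cyc y s, i) := by
  obtain ⟨x, k⟩ := l
  rcases hd k with hk | hk
  · rw [hk] at hl ⊢
    rw [siteLinkMap_self]
    intro h
    rw [mem_posBlockE, mem_shBlockE] at hl
    simp only [hij, false_and, false_or, true_and, or_false] at hl
    have hc := val_lt_two_mul hP (axisCoord d L (2 * P) x)
    have h1 := congrArg (fun l => (axisCoord d L (2 * P) l.1).val) h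
    simp only [axisCoord_cyc hij, map_sub, axisCoord_tiltedAxisFlip, axisCoord_tiltedUnit_self, val_neg_sub_one hP] at h1
    omega
  · rw [hk, siteLinkMap_other _ i _ x (Ne.symm hij)]
    exact fun h => hij (congrArg Prod.snd h).symm

/-- **The mirror image of a block link is never a letter of the free layer** (`x_i(σ x) ∈ {0} ∪ [P+1, 2P-1]`
for `0 ≤ x_i(x) ≤ P - 1`). [folklore] -/
theorem siteLinkMap_ne_freeLetter_even (hP : 2 ≤ P) (hij : i ≠ j) (hd : ∀ k : Fin d, k = i ∨ k = j)
    {l : Link (TiltedSite d i j (2 * P) (2 * P) L) d} (hl : l ∈ posBlockE d i j L P ∨ l ∈ shBlockE d i j L P)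
    {x : TiltedSite d i j (2 * P) (2 * P) L} (hx : (axisCoord d L (2 * P) x).val = P) :
    siteLinkMap (tiltedUnit d i j (2 * P) (2 * P) L) i (tiltedAxisFlip d L (2 * P) hij) l ≠ (x, j) := by
  obtain ⟨x', k⟩ := l
  rcases hd k with hk | hk
  · rw [hk, siteLinkMap_self]
    exact fun h => hij (congrArg Prod.snd h)
  · rw [hk] at hl ⊢
    rw [siteLinkMap_other _ i _ x' (Ne.symm hij)]
    intro h
    have h0 : axisCoord d L (2 * P) x' = 0 ↔ (axisCoord d L (2 * P) x').val = 0 := eq_zero_iff_val _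
    rw [mem_posBlockE, mem_shBlockE, h0] at hl
    simp only [Ne.symm hij, false_and, or_false, true_and] at hl
    have hc := val_lt_two_mul hP (axisCoord d L (2 * P) x')
    have h1 := congrArg (fun l => (axisCoord d L (2 * P) l.1).val) h
    simp only [axisCoord_tiltedAxisFlip, val_neg hP, hx] at h1
    split_ifs at h1 <;> omega

/-- Updating a rung does not change the block links. [folklore] -/
theorem update_rung_apply_of_mem_blocksE {G : Type*} [DecidableEq (TiltedSite d i j (2 * P) (2 * P) L)] (hij : i ≠ j)
    (U : Config (TiltedSite d i j (2 * P) (2 * P) L) d G) {y : TiltedSite d i j (2 * P) (2 * P) L}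
    (hy : (axisCoord d L (2 * P) y).val = P - 1 ∨ (axisCoord d L (2 * P) y).val = P) (s : ℕ) (z : G)
    (l : Link (TiltedSite d i j (2 * P) (2 * P) L) d) (hl : l ∈ posBlockE d i j L P ∨ l ∈ shBlockE d i j L P) :
    update U (cyc y s, i) z l = U l := by
  rw [update_of_ne]
  rintro rfl
  exact iLink_not_mem_blocksE hij (by rw [axisCoord_cyc hij]; exact hy) hl

/-- Updating a rung does not change the REFLECTED block links. [folklore] -/
theorem configReflect_update_rung_even {G : Type*} [Group G] [DecidableEq (TiltedSite d i j (2 * P) (2 * P) L)]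
    (hP : 2 ≤ P) (hij : i ≠ j) (hd : ∀ k : Fin d, k = i ∨ k = j)
    (U : Config (TiltedSite d i j (2 * P) (2 * P) L) d G) {y : TiltedSite d i j (2 * P) (2 * P) L}
    (hy : (axisCoord d L (2 * P) y).val = P - 1 ∨ (axisCoord d L (2 * P) y).val = P) (s : ℕ) (z : G)
    (l : Link (TiltedSite d i j (2 * P) (2 * P) L) d) (hl : l ∈ posBlockE d i j L P ∨ l ∈ shBlockE d i j L P) :
    configReflect (tiltedUnit d i j (2 * P) (2 * P) L) i (tiltedAxisFlip d L (2 * P) hij) (update U (cyc y s, i) z) l =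
      configReflect (tiltedUnit d i j (2 * P) (2 * P) L) i (tiltedAxisFlip d L (2 * P) hij) U l := by
  unfold configReflect
  rw [update_of_ne (siteLinkMap_ne_rung_even hP hij hd hl hy s)]

/-- Updating a letter of the free layer does not change the block links. [folklore] -/
theorem update_freeLetter_apply_of_mem_blocksE {G : Type*} [DecidableEq (TiltedSite d i j (2 * P) (2 * P) L)] (hij : i ≠ j)
    (U : Config (TiltedSite d i j (2 * P) (2 * P) L) d G) {x : TiltedSite d i j (2 * P) (2 * P) L}
    (hx : (axisCoord d L (2 * P) x).val = P) (z : G)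
    (l : Link (TiltedSite d i j (2 * P) (2 * P) L) d) (hl : l ∈ posBlockE d i j L P ∨ l ∈ shBlockE d i j L P) :
    update U (x, j) z l = U l := by
  rw [update_of_ne]
  rintro rfl
  exact freeLetter_not_mem_blocksE hij hx hl

/-- Updating a letter of the free layer does not change the REFLECTED block links. [folklore] -/
theorem configReflect_update_freeLetter_even {G : Type*} [Group G] [DecidableEq (TiltedSite d i j (2 * P) (2 * P) L)]
    (hP : 2 ≤ P) (hij : i ≠ j) (hd : ∀ k : Fin d, k = i ∨ k = j)
    (U : Config (TiltedSite d i j (2 * P) (2 * P) L) d G) {x : TiltedSite d i j (2 * P) (2 * P) L}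
    (hx : (axisCoord d L (2 * P) x).val = P) (z : G)
    (l : Link (TiltedSite d i j (2 * P) (2 * P) L) d) (hl : l ∈ posBlockE d i j L P ∨ l ∈ shBlockE d i j L P) :
    configReflect (tiltedUnit d i j (2 * P) (2 * P) L) i (tiltedAxisFlip d L (2 * P) hij) (update U (x, j) z) l =
      configReflect (tiltedUnit d i j (2 * P) (2 * P) L) i (tiltedAxisFlip d L (2 * P) hij) U l := by
  unfold configReflect
  rw [update_of_ne (siteLinkMap_ne_freeLetter_even hP hij hd hl hx)]

end EvenSite

/-! ## The site mirror of the even box: continuity -/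

section Measure

variable {P : ℕ} {G : Type*} [Group G] [TopologicalSpace G] [IsTopologicalGroup G]

/-- `Θ_i` is continuous on the even box. [folklore] -/
theorem continuous_configReflect_flip_even (hij : i ≠ j) :
    Continuous (configReflect (G := G) (tiltedUnit d i j (2 * P) (2 * P) L) i (tiltedAxisFlip d L (2 * P) hij)) := by
  refine continuous_pi fun l => ?_
  unfold configReflect
  split_ifs
  · exact (continuous_apply _).inv
  · exact continuous_apply _

end Measure

end TwoDim

end TiltedRP

end Summit.QuantumFields.GaugeBoot

end
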